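import Summits.AtomisticToContinuum.BoseEinsteinCondensation.Theorems.BECThomsonPrincipleFibreConductanceStubCoarseOneStep
import Summits.AtomisticToContinuum.BoseEinsteinCondensation.Theorems.BECThomsonPrincipleFibreConductanceStubCoarseFlatMass
import Summits.AtomisticToContinuum.BoseEinsteinCondensation.Theorems.BECThomsonPrincipleFibreConductanceStubMomentOfCDM
import Summits.AtomisticToContinuum.BoseEinsteinCondensation.Theorems.BECThomsonPrincipleFibreConductanceStubWeightedSobolevPoincare
import Summits.AtomisticToContinuum.BoseEinsteinCondensation.Theorems.BECThomsonPrincipleFibreConductanceStubLocalChargeSq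
import Summits.AtomisticToContinuum.BoseEinsteinCondensation.Theorems.BECThomsonPrincipleFibreConductanceStubBottomMode
import HarnessLib

/-!
# Route `BECThomsonPrinciple`, crux `FibreConductance` (stmt-AtomisticToContinuum-9480),
# line `conditional-law-poincare` — THE CRUX REDUCED TO TWO BATH MOMENTS OF THE EXACT GROUND STATE

`fibreConductance_of_conditionalDensityMoments_and_flatCoarseMass :
  ConditionalDensityMoments → FlatCoarseMassMoment → FibreConductance`

(the second hypothesis written out, no new definition): the crux `FibreConductance` follows from
gen 1's k-free landscape input `ConditionalDensityMoments` (two-sided moments of `g = L³ψ²` at uniform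
locations) and ONE infrared moment of the exact ground state — the (3/2)-th bath moment of the flat mass
of the COARSE BEAT CHARGE of the wavelength tiling, `E_W[(L³∫_cell|q_c|²dy)^{3/2}] ≤ K/‖n‖_∞³`
(`≡ 0` at `v = 0` and at `‖n‖_∞ = 1`; at first bath moment it is the single-shell occupation bound that
`infraredNecessity` shows the crux FORCES). Everything else is deterministic and in the tree:
`FibreConductance_of` (Defs) fed with the landed stubs 1, 2, 3, 4, 7, with stub 6 supplied by
`coarseBeatDualBound_of_coarseMoment` (…StubCoarseOneStep) ∘ `cellMoment_of_explicit` (here: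
`localOf 0 q_c = q_c`, one cube = the cell) ∘ `coarseCellMoment_of_flatMassMoment` (…StubCoarseFlatMass),
and stub 5 = the hypothesis. [folklore]
-/

noncomputable section

namespace Summit.AtomisticToContinuum.BoseEinsteinCondensation.Cruxes.FibreConductance.ConditionalLawPoincare

open MeasureTheory
open scoped ENNReal
open Literature.MathematicalPhysics.QuantumManyBody.BoseGas
open Summit.AtomisticToContinuum.BoseEinsteinCondensation.Theses.BECThomsonPrinciple (FibreConductance)
open Summit.AtomisticToContinuum.BoseEinsteinCondensation.Cruxes.FibreConductance.ParsevalShellBootstrap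
open Summit.AtomisticToContinuum.BoseEinsteinCondensation.Cruxes.FibreConductance.HealingSplitKineticDefect
open Summit.AtomisticToContinuum.BoseEinsteinCondensation.Cruxes.FibreConductance.TaggedPathHarnack
  (ConditionalDensityMoments)

variable {m : ℕ} {L : ℝ}

/-- The crux's charge is fibre-neutral on every fibre: `∫_cell q dy = 0` (`bottomMode_neutral`, one cube
= the cell). [folklore] -/
theorem integral_cell_cruxCharge (hL : 0 < L) (n : Fin 3 → ℤ) (Φ : PeriodicTrialState (m + 1) L)
    (hΦ : ∀ X, Φ.ψ X ≠ 0) (X : Config (m + 1)) :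
    ∫ y in cell L, cruxCharge n Φ (Function.update X 0 y) = 0 := by
  rw [← cubeSet_zero_eq_cell L (0 : Fin 3 → Fin 1)]
  exact bottomMode_neutral m L hL n Φ hΦ 0 X

/-- The explicit cell moment of `…StubCoarseFlatMass` IS the cell-scale Sobolev level of the coarse beat
charge (`localOf 0 q_c = q_c` by neutrality, one cube = the cell). [folklore] -/
theorem cellMoment_of_explicit
    (hex : LowDensityWindow fun m L n Φ B =>
      (ENNReal.ofReal L ^ 3)⁻¹ *
          ∫⁻ X in cellN (m + 1) L,
            (∫⁻ y in cell L, ‖coarseOf L (waveBlocks n) Φ (cruxCharge n Φ) (Function.update X 0 y)‖ₑ ^ 2) *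
              (∫⁻ y in cell L,
                  ENNReal.ofReal ((fibrePsi Φ (Function.update X 0 y) ^ 2) ^ (-(3 / 2 : ℝ)))) ^ (2 / 3 : ℝ) *
              ENNReal.ofReal (fibreW Φ X) ≤
        ENNReal.ofReal (B * L ^ 2 / ‖(fun j => (n j : ℝ))‖ ^ 2)) :
    LowDensityWindow fun _ L n Φ B =>
      sobolevLevelOf L 0 Φ (coarseOf L (waveBlocks n) Φ (cruxCharge n Φ)) ≤
        ENNReal.ofReal (B * L ^ 2 / ‖(fun j => (n j : ℝ))‖ ^ 2) := by
  intro v hv hbdd M hM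
  obtain ⟨ρ₀, B, hρ₀, hB, N₀, h⟩ := hex v hv hbdd M hM
  refine ⟨ρ₀, B, hρ₀, hB, N₀, fun m hm L hL hρ n hn hw Φ hE hz => ?_⟩
  have h1 := h m hm L hL hρ n hn hw Φ hE hz
  refine le_of_eq_of_le ?_ h1
  have hloc := cos_localOf_zero_coarseOf hL (waveBlocks n) Φ hz (continuous_cruxCharge hL n Φ hz)
    (integral_cell_cruxCharge hL n Φ hz)
  haveI : Unique (Fin 3 → Fin (0 + 1)) := inferInstanceAs (Unique (Fin 3 → Fin 1))
  unfold sobolevLevelOf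
  congr 1
  refine lintegral_congr fun X => ?_
  rw [Fintype.sum_unique]
  simp only [localSqOf, holeFactor, hloc, cubeSet_zero_eq_cell]

/-- **THE CRUX FROM TWO BATH MOMENTS.** `FibreConductance` follows from `ConditionalDensityMoments` and
the (3/2)-th bath moment of the flat coarse beat mass (written out): for bounded repulsive finite-range
`v` and window `M` there are `ρ₀, K, N₀` with
`∫_{cellN} (L³∫_cell|q_c(y,X̂)|²dy)^{3/2} W(X̂) dX ≤ K·L³/‖n‖³` for every datum of the crux's window and
every exact zero-free minimiser (`q_c` = the coarse part of the crux's charge at block count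
`‖n‖_∞ − 1`). Composition of the landed stubs of the line. [folklore] -/
theorem fibreConductance_of_conditionalDensityMoments_and_flatCoarseMass
    (hcdm : ConditionalDensityMoments)
    (hfm : LowDensityWindow fun m L n Φ K =>
      ∫⁻ X in cellN (m + 1) L,
          (ENNReal.ofReal (L ^ 3) * ∫⁻ y in cell L,
              ‖coarseOf L (waveBlocks n) Φ (cruxCharge n Φ) (Function.update X 0 y)‖ₑ ^ 2) ^ (3 / 2 : ℝ) *
            ENNReal.ofReal (fibreW Φ X) ≤
        ENNReal.ofReal (K * L ^ 3 / ‖(fun j => (n j : ℝ))‖ ^ 3)) :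
    FibreConductance :=
  FibreConductance_of weightedSobolevPoincare_cubeSet localChargeSq_le stub_localToGlobal stub_momentOfCDM
    hcdm (coarseBeatDualBound_of_coarseMoment weightedSobolevPoincare_cubeSet bottomMode_neutral
      (cellMoment_of_explicit (coarseCellMoment_of_flatMassMoment hcdm hfm))) bottomMode_neutral

end Summit.AtomisticToContinuum.BoseEinsteinCondensation.Cruxes.FibreConductance.ConditionalLawPoincare

end
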